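import Summits.Ventures.LatticeQCDFlow.Scaling.SwapAcceptanceKernel

/-!
HONEST FRAMING: exact (Metropolis-corrected) sampling algorithms for lattice gauge theory; figures
of merit are autocorrelation/cost numbers at stated couplings and volumes; no continuum-physics
claim.

# SwapAcceptanceMinLaw — THE MIN LAW OF THE EXACT SWAP ACCEPTANCE: FOR `s ≤ t`,
# `swapAcc(s, t) = E_{μ_s⊗μ_s}[e^{(t−s)·min(X₁,X₂)}] / E_{μ_s}[e^{(t−s)X}]` — THE STATIONARY ACCEPTANCE WITH A
# PARTNER AT ANY GAP IS A RATIO OF TWO EXPONENTIAL MOMENTS OF ONE REPLICA's OWN LAW (row 22 `su3-ptbc`,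
# GEN-8, ours; over lean-2's `SwapAcceptanceLaw` / `SwapAcceptanceKernel`)

Venture `LatticeQCDFlow` (cell pub-lqcd), topic `Scaling`; FANOUT row 22 (`su3-ptbc`, PTBC comparator arm
E4).  NEW WORK of the cell over lean-2's bounded exponential family `μ_u = μ.tilted (u·X)`
(`Scaling/SwapAcceptanceLaw`: `swapAcc X μ s t = ∫∫ min(1, e^{(t−s)(X x − X y)}) dμ_s(x) dμ_t(y)`,
`integral_exp_mul_tilted`, `integrable_exp_mul_of_bounded`) and the product form
`μ_s ⊗ μ_t = (μ⊗μ).tilted(sX ⊕ tX)` (`Scaling/SwapAcceptanceKernel.tilted_prod_tilted_mul`); Mathlib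
`integral_tilted`, `integral_prod_mul`, `integral_exp_pos`.  Nothing is cited as a fact; no numerics.

## What is proved (`μ` a probability measure, `X` bounded measurable, `s ≤ t`, `h = t − s`)

* `exp_mul_min_one_exp_eq` — the pointwise identity behind the law:
  `e^{sx + ty}·min(1, e^{h(x−y)}) = e^{sx + sy}·e^{h·min(x,y)}` (`h ≥ 0`).
* **`swapAcc_eq_min_law`** — `swapAcc X μ s t = (∫ e^{h·min(X z.1, X z.2)} d(μ_s⊗μ_s)(z)) / ∫ e^{hX} dμ_s`.

WHY (CARD-su3-ptbc §1.6, the retune step after the pilot `P0chk`): the card predicts the acceptance of a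
prospective pair from the Gaussian swap model (`erfc(ℓ/(2√2))` with `ℓ²` the measured swap variance).  The
min law is the EXACT, model-free counterpart: from equilibrium samples `x_1, …, x_n` of ONE replica at boundary
parameter `s` (its defect action values `X`), the stationary acceptance with a partner at `s + h` is the ratio
of the two U-statistics `mean_{i<j} e^{h·min(x_i,x_j)}` and `mean_i e^{h x_i}` — a reweighting estimator whose
variance grows with `h` like every reweighting, exact in expectation structure; the Gaussian model is its
second-cumulant truncation.  A report-only estimator is a successor's option; this file types the identity.

Literature grade (cell rule): KNOWN MECHANISM (single-run reweighting prediction of exchange acceptances from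
energy histograms, e.g. Rathore–Chopra–de Pablo, J. Chem. Phys. 122 (2005) 024111; Katzgraber–Trebst–Huse–Troyer
2006), NEW TYPING (the closed `min` form at measure level for every bounded linear family).  NOT CLAIMED: any
estimator's variance; the Gaussian model; any number of a run.
-/

noncomputable section

open MeasureTheory ProbabilityTheory Real Set

namespace Summit.Ventures.LatticeQCDFlow.Scaling

variable {Ω : Type*} [MeasurableSpace Ω] {μ : Measure Ω} [IsProbabilityMeasure μ] {X : Ω → ℝ}

omit [MeasurableSpace Ω] [IsProbabilityMeasure μ] in
/-- **`e^{sx + ty}·min(1, e^{(t−s)(x−y)}) = e^{sx + sy}·e^{(t−s)·min(x,y)}`** for `s ≤ t`: below the diagonal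
the swap is accepted surely and the weight keeps `e^{ty} = e^{sy}e^{(t−s)y}`; above it the Metropolis factor
trades `e^{ty}` for `e^{tx}`. [folklore] -/
theorem exp_mul_min_one_exp_eq {s t : ℝ} (hst : s ≤ t) (x y : ℝ) :
    exp (s * x + t * y) * min 1 (exp ((t - s) * (x - y))) = exp (s * x + s * y) * exp ((t - s) * min x y) := by
  rcases le_or_gt y x with hyx | hxy
  · rw [min_eq_left (one_le_exp (mul_nonneg (sub_nonneg.2 hst) (sub_nonneg.2 hyx))), min_eq_right hyx,
      mul_one, ← exp_add]
    congr 1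
    ring
  · rw [min_eq_right (exp_le_one_iff.2 (mul_nonpos_of_nonneg_of_nonpos (sub_nonneg.2 hst)
      (sub_nonpos.2 hxy.le))), min_eq_left hxy.le, ← exp_add, ← exp_add]
    congr 1
    ring

/-- **THE MIN LAW.**  For `s ≤ t` (`h = t − s`):
`swapAcc X μ s t = E_{μ_s⊗μ_s}[e^{h·min(X₁,X₂)}] / E_{μ_s}[e^{hX}]` — the exact stationary swap acceptance
with a partner at gap `h` is the exponential moment of the MINIMUM of two independent copies of the replica's
own `X`, over the exponential moment of one copy. [ours] -/
theorem swapAcc_eq_min_law (hXm : Measurable X) (hXb : ∃ C, ∀ ω, |X ω| ≤ C) {s t : ℝ} (hst : s ≤ t) :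
    swapAcc X μ s t
      = (∫ z, exp ((t - s) * min (X z.1) (X z.2))
            ∂((μ.tilted fun ω => s * X ω).prod (μ.tilted fun ω => s * X ω)))
          / ∫ ω, exp ((t - s) * X ω) ∂(μ.tilted fun ω => s * X ω) := by
  set Zs : ℝ := ∫ ω, exp (s * X ω) ∂μ with hZs_def
  set Zt : ℝ := ∫ ω, exp (t * X ω) ∂μ with hZt_def
  have hZs : 0 < Zs := integral_exp_pos (integrable_exp_mul_of_bounded hXm hXb s)
  have hZt : 0 < Zt := integral_exp_pos (integrable_exp_mul_of_bounded hXm hXb t)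
  have hCst : ∫ z, exp (s * X z.1 + t * X z.2) ∂(μ.prod μ) = Zs * Zt := by
    simp_rw [exp_add]
    exact integral_prod_mul (fun x => exp (s * X x)) (fun y => exp (t * X y))
  have hCss : ∫ z, exp (s * X z.1 + s * X z.2) ∂(μ.prod μ) = Zs * Zs := by
    simp_rw [exp_add]
    exact integral_prod_mul (fun x => exp (s * X x)) (fun y => exp (s * X y))
  -- denominator: `∫ e^{hX} dμ_s = Z_t / Z_s`
  have hden : ∫ ω, exp ((t - s) * X ω) ∂(μ.tilted fun ω => s * X ω) = Zt / Zs := by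
    rw [integral_exp_mul_tilted, add_sub_cancel]
    rfl
  -- numerator over the base product measure
  have hnum : ∫ z, exp ((t - s) * min (X z.1) (X z.2))
        ∂((μ.tilted fun ω => s * X ω).prod (μ.tilted fun ω => s * X ω))
      = (Zs * Zs)⁻¹ * ∫ z, exp (s * X z.1 + s * X z.2) * exp ((t - s) * min (X z.1) (X z.2)) ∂(μ.prod μ) := by
    rw [tilted_prod_tilted_mul hXm s s, integral_tilted, ← integral_const_mul]
    refine integral_congr_ae (ae_of_all _ fun z => ?_)
    simp only [smul_eq_mul]
    rw [hCss]
    ring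
  -- the acceptance over the base product measure, then the pointwise identity
  have hacc : swapAcc X μ s t
      = (Zs * Zt)⁻¹ * ∫ z, exp (s * X z.1 + s * X z.2) * exp ((t - s) * min (X z.1) (X z.2)) ∂(μ.prod μ) := by
    unfold swapAcc
    rw [tilted_prod_tilted_mul hXm s t, integral_tilted, ← integral_const_mul]
    refine integral_congr_ae (ae_of_all _ fun z => ?_)
    simp only [smul_eq_mul]
    rw [hCst, ← exp_mul_min_one_exp_eq hst (X z.1) (X z.2)]
    ring
  rw [hacc, hnum, hden]
  field_simp

end Summit.Ventures.LatticeQCDFlow.Scaling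

end
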